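import Summits.AtomisticToContinuum.Crystallization.Theorems.HullExactificationCascadeHcpLandscapeGapExactBarlowPricing
import Summits.AtomisticToContinuum.Crystallization.Theorems.HullExactificationCascadeHcpLandscapeGapStubWindowColumnSum
import Summits.AtomisticToContinuum.Crystallization.Theorems.HullExactificationCascadeHcpLandscapeGapStubGoodOfDeepSite
import Summits.AtomisticToContinuum.Crystallization.Theorems.HullExactificationCascadeHcpLandscapeGapStubFibreCharge
import Summits.AtomisticToContinuum.Crystallization.Theorems.HullExactificationCascadeHcpLandscapeGapStubFibreDecomposition
import Summits.AtomisticToContinuum.Crystallization.Theorems.HullExactificationCascadeHcpLandscapeGapRelaxedWindowEnergy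

/-!
# Crux `HcpLandscapeGap` (stmt-AtomisticToContinuum-12087), line `registered` (birth): T_relaxed
# (`stub_relaxedBarlowPricing`, lead assembly of skeleton v12; `relaxedBarlowPricing_unmoved` + rigid-motion transport)

B's priced inequality, in T's finite-window form, for every window `S ∩ B̄_L(c)` of a Barlow MULTILATTICE
`S = barlowStackingH a' H s` (perfect triangular layers in exact A/B/C registry, in-layer scale `a' ∈ [47/50, 1]`,
ARBITRARY height profile `H` with every spacing in `[39a'/50, 17a'/20]`, every Hägg word `s`), at B's box
minimiser `(a, h)`:

  `n · e_LJ(hcp a h) + κ · #{i : ¬Good_x(4, θ, i)} ≤ 𝓔_LJ(x) + C (L+1)²`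

for every injective enumeration `x` of the window, and then (registered stub `stub_relaxedBarlowPricing` = T_relaxed of
skeleton v10–v12) for windows of every RIGID IMAGE `v + B '' S` (transport: `B` upgrades to a linear isometry
equivalence of `ℝ³`, pull the window back, energies and the Good predicate are invariant).  Assembly of the unmoved
case over the landed pieces of the relaxed-Barlow cut (lead c6):

* `stub_fibreDecomposition` (RF, p163443): the window is a disjoint union of `≤ C_F (L+1)²` vertical fibre
  intervals up to points within depth `5` of the boundary sphere;
* `stub_windowColumnSum` (X5, p167043; over RC `stub_relaxedColumn` p166305 and RS `stub_siteEnergyHeights` p163097):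
  `n·2e* + g·Σ_f Σ_{k ∈ fibre f} price(k) ≤ Σ_i (full site energy of x i) + C₅ (#F + #boundary + 1)`, with
  `price(k) = [s (k+1) = s k] + (a' − a)² + (H (k+1) − H k − h)²`;
* `stub_windowEnergyHeights` (RE, p164228): `Σ_i (full site energy of x i) ≤ 2 𝓔_LJ(x)`;
* `stub_boundaryLayer` (p147788): `#boundary ≤ C_b (L+1)²` for the `7/10`-separated `S`;
* `stub_goodOfDeepSite` (X2, p166565; over RG `stub_goodOfNoBadBondHeights` p163150): a window site at depth `≥ 5`
  with `|a' − a| ≤ δ₁`, no cubic bond and `δ₁`-good spacings within `K` layers is `Good(4, θ)`;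
* `stub_fibreCharge` (X1, p166631): per fibre, the layers that are off-scale, or within `K` of a cubic bond or of an
  off spacing, number `≤ (2K+1)(1+δ₁⁻²)·Σ price + 4K(2K+1)`.

So `#bad ≤ #boundary + Σ_f [(2K+1)(1+δ₁⁻²) Σ_{fibre f} price + 4K(2K+1)]` (bad deep sites inject into bad fibre layers),
and `κ = g / (2 (2K+1)(1+δ₁⁻²))` makes the prices pay.  All `[folklore]`.
-/

noncomputable section

namespace Summit.AtomisticToContinuum.Crystallization.Theorems.HcpLandscapeGapBirth

open Literature.MathematicalPhysics.StatisticalMechanics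
open Summit.AtomisticToContinuum.Crystallization.Theorems

/-- **T_relaxed for the unmoved multilattice** (helper of the registered stub `stub_relaxedBarlowPricing`; see the
module docstring for the statement and the assembly). [folklore] -/
theorem relaxedBarlowPricing_unmoved : ∀ (a h : ℝ) (ha : a ≠ 0) (hh : h ≠ 0), (9 / 10 < a ∧ a < 1 ∧ |h - a * Real.sqrt (2 / 3)| ≤ a / 100) → (∀ a' h' : ℝ, ∀ ha' : a' ≠ 0, ∀ hh' : h' ≠ 0, (9 / 10 < a' ∧ a' < 1 ∧ |h' - a' * Real.sqrt (2 / 3)| ≤ a' / 100) → (Literature.MathematicalPhysics.StatisticalMechanics.hcpPeriodicConfiguration ha hh).energyPerParticle Literature.MathematicalPhysics.StatisticalMechanics.lennardJones ≤ (Literature.MathematicalPhysics.StatisticalMechanics.hcpPeriodicConfiguration ha' hh').energyPerParticle Literature.MathematicalPhysics.StatisticalMechanics.lennardJones) → ∀ θ : ℝ, 0 < θ → ∃ κ : ℝ, 0 < κ ∧ ∃ C : ℝ, ∀ (a' : ℝ), 47 / 50 ≤ a' → a' ≤ 1 → ∀ s : ℤ → ℤ, Literature.MathematicalPhysics.StatisticalMechanics.IsHaggSeq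 s → ∀ H : ℤ → ℝ, (∀ k : ℤ, 39 / 50 * a' ≤ H (k + 1) - H k ∧ H (k + 1) - H k ≤ 17 / 20 * a') → ∀ (c : EuclideanSpace ℝ (Fin 3)) (L : ℝ), 0 ≤ L → ∀ (n : ℕ) (x : Fin n → EuclideanSpace ℝ (Fin 3)), Function.Injective x → Set.range x = {y : EuclideanSpace ℝ (Fin 3) | y ∈ Literature.MathematicalPhysics.StatisticalMechanics.barlowStackingH a' H s ∧ dist y c ≤ L} → (n : ℝ) * (Literature.MathematicalPhysics.StatisticalMechanics.hcpPeriodicConfiguration ha hh).energyPerParticle Literature.MathematicalPhysics.StatisticalMechanics.lennardJones + κ * (Nat.card {i : Fin n // ¬ (∃ A : EuclideanSpace ℝ (Fin 3) →ₗᵢ[ℝ] EuclideanSpace ℝ (Fin 3), (∀ p ∈ (Literature.MathematicalPhysics.StatisticalMechanics.hcpPeriodicConfiguration ha hh).points, ‖p‖ ≤ 4 → ∃ j : Fin n, dist (x j) (x i + A p) ≤ θ) ∧ (∀ j : Fin n, dist (x j) (x i) ≤ 4 → ∃ p ∈ (Literature.MathematicalPhysics.StatisticalMechanics.hcpPeriodicConfiguration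 ha hh).points, dist (x j) (x i + A p) ≤ θ))} : ℝ) ≤ Literature.MathematicalPhysics.StatisticalMechanics.interactionEnergy Literature.MathematicalPhysics.StatisticalMechanics.lennardJones x + C * (L + 1) ^ 2 := by
  classical
  intro a h ha hh hbox hmin θ hθ
  obtain ⟨⟨ha1, ha2, hh1, hh2⟩, -⟩ := modulus_at_boxMinimiser a h ha hh hbox hmin
  have ha0 : 0 < a := by linarith
  have hh0 : 0 < h := by linarith
  have hhle1 : h ≤ 1 := by linarith
  obtain ⟨g, hg, C₅, hX5⟩ := stub_windowColumnSum a h ha hh hbox hmin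
  obtain ⟨δ₁, hδ₁, K, hX2⟩ := stub_goodOfDeepSite a h ha0 hh0 hhle1 θ hθ
  obtain ⟨CF, hRF⟩ := stub_fibreDecomposition
  obtain ⟨Cb, hCb⟩ := stub_boundaryLayer (7 / 10) (by norm_num) 5 (by norm_num)
  -- constants
  obtain ⟨c₁, hc₁def⟩ : ∃ c₁ : ℝ, c₁ = (2 * K + 1) * (1 + δ₁⁻¹ ^ 2) := ⟨_, rfl⟩
  obtain ⟨A₀, hA₀def⟩ : ∃ A₀ : ℝ, A₀ = 4 * K * (2 * K + 1) := ⟨_, rfl⟩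
  have hc₁ : 0 < c₁ := by rw [hc₁def]; positivity
  have hA₀ : 0 ≤ A₀ := by rw [hA₀def]; positivity
  obtain ⟨κ, hκdef⟩ : ∃ κ : ℝ, κ = g / (2 * c₁) := ⟨_, rfl⟩
  have hκ : 0 < κ := by rw [hκdef]; positivity
  have hκc₁ : κ * c₁ = g / 2 := by rw [hκdef]; field_simp
  refine ⟨κ, hκ, max C₅ 0 * (max CF 0 + max Cb 0 + 1) + κ * (max Cb 0 + A₀ * max CF 0), ?_⟩
  intro a' ha' ha'1 s hs H hH c L hL n x hx hrange
  have hgap : ∀ k : ℤ, 39 / 50 * a' ≤ H (k + 1) - H k := fun k => (hH k).1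
  have hmemS : ∀ i : Fin n, x i ∈ barlowStackingH a' H s ∧ dist (x i) c ≤ L := fun i => by
    have hi : x i ∈ Set.range x := Set.mem_range_self i
    rw [hrange] at hi
    exact hi
  -- the fibre decomposition of the window
  obtain ⟨F, M₁, M₂, ι, hFcard, hιinj, hcov, hunc⟩ := hRF a' ha' ha'1 s hs H hH c L hL
  -- (1) energy
  have hE5 := hX5 a' ha' ha'1 s hs H hH c L n x hx hrange F M₁ M₂ ι hιinj hcov hunc
  have hRE := stub_windowEnergyHeights a' ha' ha'1 s hs H hH n x hx fun t => (hmemS t).1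
  -- the boundary layer
  obtain ⟨Bdy, hBdy⟩ : ∃ B : Set (EuclideanSpace ℝ (Fin 3)),
      B = {p : EuclideanSpace ℝ (Fin 3) | p ∈ barlowStackingH a' H s ∧ dist p c ≤ L ∧ L - 5 < dist p c} :=
    ⟨_, rfl⟩
  have hbdy : (Bdy.ncard : ℝ) ≤ Cb * (L + 1) ^ 2 := by
    rw [hBdy]
    exact (hCb _ (RelaxedWindowEnergy.sep_barlowStackingH (s := s) ha' hgap) c L hL).1
  rw [← hBdy] at hE5
  have hBfin : Bdy.Finite := by
    refine (Set.finite_range x).subset fun p hp => ?_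
    rw [hrange]
    rw [hBdy] at hp
    exact ⟨hp.1, hp.2.1⟩
  -- (2) counting the bad sites
  -- every window point has multilattice indices
  choose kf pf qf hxeq using fun i : Fin n => (mem_barlowStackingH_iff).1 (hmemS i).1
  -- the reasons for badness of a layer
  obtain ⟨R, hR⟩ : ∃ R : ℤ → Prop, ∀ k : ℤ, R k ↔ (δ₁ < |a' - a| ∨ (∃ k' : ℤ, |k' - k| ≤ K ∧ s (k' + 1) = s k') ∨
      (∃ k' : ℤ, |k' - k| ≤ K ∧ δ₁ < |H (k' + 1) - H k' - h|)) := ⟨_, fun _ => Iff.rfl⟩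
  -- the Good predicate
  obtain ⟨P, hP⟩ : ∃ P : Fin n → Prop, ∀ i : Fin n, P i ↔ ¬ (∃ A : EuclideanSpace ℝ (Fin 3) →ₗᵢ[ℝ] EuclideanSpace ℝ (Fin 3),
      (∀ p ∈ (hcpPeriodicConfiguration ha hh).points, ‖p‖ ≤ 4 → ∃ j : Fin n, dist (x j) (x i + A p) ≤ θ) ∧
      (∀ j : Fin n, dist (x j) (x i) ≤ 4 → ∃ p ∈ (hcpPeriodicConfiguration ha hh).points,
        dist (x j) (x i + A p) ≤ θ)) := ⟨_, fun _ => Iff.rfl⟩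
  have hcardP : (Nat.card {i : Fin n // ¬ (∃ A : EuclideanSpace ℝ (Fin 3) →ₗᵢ[ℝ] EuclideanSpace ℝ (Fin 3),
      (∀ p ∈ (hcpPeriodicConfiguration ha hh).points, ‖p‖ ≤ 4 → ∃ j : Fin n, dist (x j) (x i + A p) ≤ θ) ∧
      (∀ j : Fin n, dist (x j) (x i) ≤ 4 → ∃ p ∈ (hcpPeriodicConfiguration ha hh).points,
        dist (x j) (x i + A p) ≤ θ))} : ℝ) = ((Finset.univ.filter P).card : ℝ) := by
    rw [natCard_subtype_eq_card_filter]
    congr 2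
    exact Finset.filter_congr fun i _ => (hP i).symm
  rw [hcardP]
  -- deep bad sites have a bad reason in their fibre
  have hreason : ∀ i : Fin n, P i → dist (x i) c ≤ L - 5 → R (kf i) := by
    intro i hPi hdeep
    rw [hR]
    by_contra hcon
    push Not at hcon
    obtain ⟨h1, h2, h3⟩ := hcon
    apply (hP i).1 hPi
    obtain ⟨A, hA⟩ := hX2 a' h1 ha' ha'1 s hs H hH c L n x hrange i (kf i) (pf i) (qf i) (hxeq i) hdeep
      (fun k' hk' heq => h2 k' hk' heq) (fun k' hk' => h3 k' hk')
    refine ⟨A, ?_⟩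
    rw [hcpPeriodicConfiguration_points ha hh]
    exact hA
  -- deep covered sites: the covering fibre and layer
  have hcovered : ∀ i : Fin n, dist (x i) c ≤ L - 5 →
      ∃ f ∈ F, M₁ f ≤ kf i ∧ kf i ≤ M₂ f ∧ ι f (kf i) = (pf i, qf i) := by
    intro i hdeep
    rcases hunc (kf i) (pf i) (qf i) (by rw [← hxeq i]; exact (hmemS i).2) with h1 | h1
    · exact h1
    · exfalso
      rw [← hxeq i] at h1
      linarith
  obtain ⟨ff, hff⟩ : ∃ ff : Fin n → ℤ × ℤ, ∀ i : Fin n, dist (x i) c ≤ L - 5 →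
      ff i ∈ F ∧ M₁ (ff i) ≤ kf i ∧ kf i ≤ M₂ (ff i) ∧ ι (ff i) (kf i) = (pf i, qf i) := by
    refine ⟨fun i => if hd : dist (x i) c ≤ L - 5 then (hcovered i hd).choose else (0, 0), fun i hd => ?_⟩
    simp only [dif_pos hd]
    obtain ⟨h1, h2⟩ := (hcovered i hd).choose_spec
    exact ⟨h1, h2⟩
  -- the finsets
  set Bad := Finset.univ.filter P with hBad
  set Bdry := Finset.univ.filter (fun i : Fin n => L - 5 < dist (x i) c) with hBdry
  set Deep := Finset.univ.filter (fun i : Fin n => P i ∧ dist (x i) c ≤ L - 5) with hDeep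
  set BadFK := F.sigma (fun f => (Finset.Icc (M₁ f) (M₂ f)).filter fun k => R k) with hBadFK
  have hsplit : Bad.card ≤ Bdry.card + Deep.card := by
    calc Bad.card ≤ (Bdry ∪ Deep).card := by
          refine Finset.card_le_card fun i hi => ?_
          rw [hBad, Finset.mem_filter] at hi
          rw [Finset.mem_union, hBdry, hDeep, Finset.mem_filter, Finset.mem_filter]
          by_cases hd : dist (x i) c ≤ L - 5
          · exact Or.inr ⟨Finset.mem_univ _, hi.2, hd⟩
          · exact Or.inl ⟨Finset.mem_univ _, by linarith⟩
      _ ≤ Bdry.card + Deep.card := Finset.card_union_le _ _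
  -- boundary indices inject into the boundary layer
  have hBdry_le : (Bdry.card : ℝ) ≤ (Bdy.ncard : ℝ) := by
    have h1 : Bdry.card = (Bdry.image x).card := (Finset.card_image_of_injective _ hx).symm
    have h2 : Bdry.image x ⊆ hBfin.toFinset := by
      intro p hp
      rw [Finset.mem_image] at hp
      obtain ⟨i, hi, rfl⟩ := hp
      rw [hBdry, Finset.mem_filter] at hi
      rw [Set.Finite.mem_toFinset, hBdy]
      exact ⟨(hmemS i).1, (hmemS i).2, hi.2⟩
    have h3 := Finset.card_le_card h2
    rw [← Set.ncard_eq_toFinset_card Bdy hBfin] at h3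
    exact_mod_cast h1.le.trans h3
  -- deep bad indices inject into bad fibre layers
  have hDeep_le : Deep.card ≤ BadFK.card := by
    refine Finset.card_le_card_of_injOn (fun i => (⟨ff i, kf i⟩ : (Σ _ : ℤ × ℤ, ℤ))) ?_ ?_
    · intro i hi
      rw [Finset.mem_coe, hDeep, Finset.mem_filter] at hi
      obtain ⟨hf1, hf2, hf3, -⟩ := hff i hi.2.2
      rw [Finset.mem_coe, hBadFK, Finset.mem_sigma, Finset.mem_filter, Finset.mem_Icc]
      exact ⟨hf1, ⟨hf2, hf3⟩, hreason i hi.2.1 hi.2.2⟩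
    · intro i hi i' hi' heq
      rw [Finset.mem_coe, hDeep, Finset.mem_filter] at hi hi'
      simp only [Sigma.mk.injEq, heq_eq_eq] at heq
      obtain ⟨hfeq, hkeq⟩ := heq
      have h4 := (hff i hi.2.2).2.2.2
      have h4' := (hff i' hi'.2.2).2.2.2
      rw [hfeq, hkeq] at h4
      rw [h4] at h4'
      have hpq : pf i = pf i' ∧ qf i = qf i' := by
        simpa [Prod.mk.injEq] using h4'
      apply hx
      rw [hxeq i, hxeq i', hkeq, hpq.1, hpq.2]
  -- bad fibre layers are charged to the prices
  have hBadFK_le : (BadFK.card : ℝ) ≤ c₁ * (∑ f ∈ F, ∑ k ∈ Finset.Icc (M₁ f) (M₂ f),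
      ((if s (k + 1) = s k then (1 : ℝ) else 0) + (a' - a) ^ 2 + (H (k + 1) - H k - h) ^ 2)) + A₀ * F.card := by
    rw [hBadFK, Finset.card_sigma, Nat.cast_sum, Finset.mul_sum]
    have hper : ∀ f ∈ F, (((Finset.Icc (M₁ f) (M₂ f)).filter fun k => R k).card : ℝ) ≤
        c₁ * (∑ k ∈ Finset.Icc (M₁ f) (M₂ f),
          ((if s (k + 1) = s k then (1 : ℝ) else 0) + (a' - a) ^ 2 + (H (k + 1) - H k - h) ^ 2)) + A₀ := by
      intro f _
      have hX1 := stub_fibreCharge K δ₁ hδ₁ s H a a' h (M₁ f) (M₂ f)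
      have hset : {k : ℤ | M₁ f ≤ k ∧ k ≤ M₂ f ∧ (δ₁ < |a' - a| ∨ (∃ k' : ℤ, |k' - k| ≤ K ∧ s (k' + 1) = s k') ∨
          (∃ k' : ℤ, |k' - k| ≤ K ∧ δ₁ < |H (k' + 1) - H k' - h|))} =
          ↑((Finset.Icc (M₁ f) (M₂ f)).filter fun k => R k) := by
        ext k
        rw [Finset.coe_filter, Set.mem_setOf_eq, Set.mem_setOf_eq, Finset.mem_Icc, hR, and_assoc]
      rw [hset, Set.ncard_coe_finset] at hX1
      rw [hc₁def, hA₀def]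
      exact hX1
    calc ∑ f ∈ F, (((Finset.Icc (M₁ f) (M₂ f)).filter fun k => R k).card : ℝ)
        ≤ ∑ f ∈ F, (c₁ * (∑ k ∈ Finset.Icc (M₁ f) (M₂ f),
          ((if s (k + 1) = s k then (1 : ℝ) else 0) + (a' - a) ^ 2 + (H (k + 1) - H k - h) ^ 2)) + A₀) :=
          Finset.sum_le_sum hper
      _ = _ := by rw [Finset.sum_add_distrib, Finset.sum_const, nsmul_eq_mul]; ring
  -- (3) the final arithmetic
  have hprice0 : 0 ≤ ∑ f ∈ F, ∑ k ∈ Finset.Icc (M₁ f) (M₂ f),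
      ((if s (k + 1) = s k then (1 : ℝ) else 0) + (a' - a) ^ 2 + (H (k + 1) - H k - h) ^ 2) := by
    refine Finset.sum_nonneg fun f _ => Finset.sum_nonneg fun k _ => ?_
    have : (0 : ℝ) ≤ (if s (k + 1) = s k then (1 : ℝ) else 0) := by split_ifs <;> norm_num
    positivity
  have hbad : (Bad.card : ℝ) ≤ (Bdy.ncard : ℝ) + c₁ * (∑ f ∈ F, ∑ k ∈ Finset.Icc (M₁ f) (M₂ f),
      ((if s (k + 1) = s k then (1 : ℝ) else 0) + (a' - a) ^ 2 + (H (k + 1) - H k - h) ^ 2)) + A₀ * F.card := by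
    have h1 : (Bad.card : ℝ) ≤ (Bdry.card : ℝ) + (Deep.card : ℝ) := by
      exact_mod_cast hsplit
    have h2 : (Deep.card : ℝ) ≤ (BadFK.card : ℝ) := by exact_mod_cast hDeep_le
    linarith [hBdry_le, hBadFK_le]
  -- nonnegativity and the window constants
  have hL1 : (1 : ℝ) ≤ (L + 1) ^ 2 := by nlinarith
  have hFle : (F.card : ℝ) ≤ max CF 0 * (L + 1) ^ 2 :=
    hFcard.trans (mul_le_mul_of_nonneg_right (le_max_left _ _) (by positivity))
  have hBle : (Bdy.ncard : ℝ) ≤ max Cb 0 * (L + 1) ^ 2 :=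
    hbdy.trans (mul_le_mul_of_nonneg_right (le_max_left _ _) (by positivity))
  have hC5 : C₅ * ((F.card : ℝ) + (Bdy.ncard : ℝ) + 1) ≤ max C₅ 0 * ((F.card : ℝ) + (Bdy.ncard : ℝ) + 1) :=
    mul_le_mul_of_nonneg_right (le_max_left _ _) (by positivity)
  have hC5' : max C₅ 0 * ((F.card : ℝ) + (Bdy.ncard : ℝ) + 1) ≤
      max C₅ 0 * (max CF 0 + max Cb 0 + 1) * (L + 1) ^ 2 := by
    have : (F.card : ℝ) + (Bdy.ncard : ℝ) + 1 ≤ (max CF 0 + max Cb 0 + 1) * (L + 1) ^ 2 := by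
      have e : (max CF 0 + max Cb 0 + 1) * (L + 1) ^ 2 =
          max CF 0 * (L + 1) ^ 2 + max Cb 0 * (L + 1) ^ 2 + (L + 1) ^ 2 := by ring
      rw [e]; linarith [hFle, hBle, hL1]
    calc max C₅ 0 * ((F.card : ℝ) + (Bdy.ncard : ℝ) + 1)
        ≤ max C₅ 0 * ((max CF 0 + max Cb 0 + 1) * (L + 1) ^ 2) :=
          mul_le_mul_of_nonneg_left this (le_max_right _ _)
      _ = _ := by ring
  have hκbad := mul_le_mul_of_nonneg_left hbad hκ.le
  have hκB : κ * (Bdy.ncard : ℝ) ≤ κ * (max Cb 0 * (L + 1) ^ 2) := mul_le_mul_of_nonneg_left hBle hκ.le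
  have hκF : κ * (A₀ * (F.card : ℝ)) ≤ κ * (A₀ * (max CF 0 * (L + 1) ^ 2)) :=
    mul_le_mul_of_nonneg_left (mul_le_mul_of_nonneg_left hFle hA₀) hκ.le
  have hgp : κ * (c₁ * (∑ f ∈ F, ∑ k ∈ Finset.Icc (M₁ f) (M₂ f),
      ((if s (k + 1) = s k then (1 : ℝ) else 0) + (a' - a) ^ 2 + (H (k + 1) - H k - h) ^ 2))) =
      g / 2 * (∑ f ∈ F, ∑ k ∈ Finset.Icc (M₁ f) (M₂ f),
      ((if s (k + 1) = s k then (1 : ℝ) else 0) + (a' - a) ^ 2 + (H (k + 1) - H k - h) ^ 2)) := by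
    rw [← mul_assoc, hκc₁]
  have hCQ0 : 0 ≤ max C₅ 0 * (max CF 0 + max Cb 0 + 1) * (L + 1) ^ 2 := by positivity
  clear_value Bad Bdry Deep BadFK
  linarith [hE5, hRE, hκbad, hκB, hκF, hgp, hC5, hC5', hprice0, hCQ0]

/-- **T_relaxed** (registered stub `stub_relaxedBarlowPricing` of skeleton v10–v12 of crux stmt-AtomisticToContinuum-12087):
B's priced inequality, in T's finite-window form, for windows of every rigid image `v + B '' barlowStackingH a' H s` of a
Barlow multilattice (every Hägg word, every spacing profile in the band, every in-layer scale in `[47/50, 1]`), at B's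
box minimiser.  Transport of `relaxedBarlowPricing_unmoved` along the rigid motion. [folklore] -/
theorem stub_relaxedBarlowPricing : ∀ (a h : ℝ) (ha : a ≠ 0) (hh : h ≠ 0), (9 / 10 < a ∧ a < 1 ∧ |h - a * Real.sqrt (2 / 3)| ≤ a / 100) → (∀ a' h' : ℝ, ∀ ha' : a' ≠ 0, ∀ hh' : h' ≠ 0, (9 / 10 < a' ∧ a' < 1 ∧ |h' - a' * Real.sqrt (2 / 3)| ≤ a' / 100) → (Literature.MathematicalPhysics.StatisticalMechanics.hcpPeriodicConfiguration ha hh).energyPerParticle Literature.MathematicalPhysics.StatisticalMechanics.lennardJones ≤ (Literature.MathematicalPhysics.StatisticalMechanics.hcpPeriodicConfiguration ha' hh').energyPerParticle Literature.MathematicalPhysics.StatisticalMechanics.lennardJones) → ∀ θ : ℝ, 0 < θ → ∃ κ : ℝ, 0 < κ ∧ ∃ C : ℝ, ∀ (a' : ℝ), 47 / 50 ≤ a' → a' ≤ 1 → ∀ s : ℤ → ℤ, Literature.MathematicalPhysics.StatisticalMechanics.IsHaggSeq s → ∀ H : ℤ → ℝ, (∀ k : ℤ, 39 / 50 * a' ≤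 H (k + 1) - H k ∧ H (k + 1) - H k ≤ 17 / 20 * a') → ∀ (B : EuclideanSpace ℝ (Fin 3) →ₗᵢ[ℝ] EuclideanSpace ℝ (Fin 3)) (v c : EuclideanSpace ℝ (Fin 3)) (L : ℝ), 0 ≤ L → ∀ (n : ℕ) (x : Fin n → EuclideanSpace ℝ (Fin 3)), Function.Injective x → Set.range x = {y : EuclideanSpace ℝ (Fin 3) | y ∈ (fun w => v + B w) '' Literature.MathematicalPhysics.StatisticalMechanics.barlowStackingH a' H s ∧ dist y c ≤ L} → (n : ℝ) * (Literature.MathematicalPhysics.StatisticalMechanics.hcpPeriodicConfiguration ha hh).energyPerParticle Literature.MathematicalPhysics.StatisticalMechanics.lennardJones + κ * (Nat.card {i : Fin n // ¬ (∃ A : EuclideanSpace ℝ (Fin 3) →ₗᵢ[ℝ] EuclideanSpace ℝ (Fin 3), (∀ p ∈ (Literature.MathematicalPhysics.StatisticalMechanics.hcpPeriodicConfiguration ha hh).points, ‖p‖ ≤ 4 → ∃ j : Fin n, dist (x j) (x i + A p) ≤ θ) ∧ (∀ j : Fin n, dist (x j) (x i) ≤ 4 → ∃ p ∈ (Literature.MathematicalPhysics.StatisticalMechanics.hcpPeriodicConfiguration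 ha hh).points, dist (x j) (x i + A p) ≤ θ))} : ℝ) ≤ Literature.MathematicalPhysics.StatisticalMechanics.interactionEnergy Literature.MathematicalPhysics.StatisticalMechanics.lennardJones x + C * (L + 1) ^ 2 := by
  intro a h ha hh hbox hmin θ hθ
  obtain ⟨κ, hκ, C, hmain⟩ := relaxedBarlowPricing_unmoved a h ha hh hbox hmin θ hθ
  refine ⟨κ, hκ, C, ?_⟩
  intro a' ha' ha'1 s hs H hH B v c L hL n x hx hrange
  -- upgrade `B` to a linear isometry equivalence of `ℝ³` and pull the window back
  set Be : EuclideanSpace ℝ (Fin 3) ≃ₗᵢ[ℝ] EuclideanSpace ℝ (Fin 3) := B.toLinearIsometryEquiv rfl with hBe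
  have hBeB : ∀ w, Be w = B w := fun w => rfl
  set y : Fin n → EuclideanSpace ℝ (Fin 3) := fun i => Be.symm (x i - v) with hy
  have hxy : ∀ i, x i = v + B (y i) := by
    intro i
    rw [← hBeB, hy]
    simp only [LinearIsometryEquiv.apply_symm_apply, add_sub_cancel]
  have hyinj : Function.Injective y := by
    intro i j hij
    apply hx
    rw [hxy i, hxy j, hij]
  have hmemx : ∀ i : Fin n, x i ∈ (fun w => v + B w) '' barlowStackingH a' H s ∧ dist (x i) c ≤ L := fun i => by
    have hi : x i ∈ Set.range x := Set.mem_range_self i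
    rw [hrange] at hi
    exact hi
  have hdistc : ∀ p : EuclideanSpace ℝ (Fin 3), dist (v + B p) c = dist p (Be.symm (c - v)) := by
    intro p
    rw [← Be.dist_map p (Be.symm (c - v)), LinearIsometryEquiv.apply_symm_apply, hBeB,
      ← dist_add_left v (B p) (c - v), add_sub_cancel]
  have hyrange : Set.range y = {p : EuclideanSpace ℝ (Fin 3) |
      p ∈ barlowStackingH a' H s ∧ dist p (Be.symm (c - v)) ≤ L} := by
    ext p
    constructor
    · rintro ⟨i, rfl⟩
      obtain ⟨⟨w, hw, hwx⟩, hdx⟩ := hmemx i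
      have hyw : y i = w := by
        rw [hy]
        show Be.symm (x i - v) = w
        rw [← hwx, add_sub_cancel_left, ← hBeB, LinearIsometryEquiv.symm_apply_apply]
      refine ⟨hyw ▸ hw, ?_⟩
      rw [← hdistc, ← hxy i]
      exact hdx
    · rintro ⟨hpS, hpd⟩
      have hp : v + B p ∈ Set.range x := by
        rw [hrange]
        exact ⟨⟨p, hpS, rfl⟩, by rw [hdistc]; exact hpd⟩
      obtain ⟨i, hi⟩ := hp
      refine ⟨i, ?_⟩
      rw [hy]
      show Be.symm (x i - v) = p
      rw [hi, add_sub_cancel_left, ← hBeB, LinearIsometryEquiv.symm_apply_apply]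
  have h := hmain a' ha' ha'1 s hs H hH (Be.symm (c - v)) L hL n y hyinj hyrange
  -- energies agree
  have hdist2 : ∀ i j : Fin n, dist (x j) (x i) = dist (y j) (y i) := by
    intro i j
    rw [hxy i, hxy j, dist_add_left, B.dist_map]
  have hE : interactionEnergy lennardJones x = interactionEnergy lennardJones y := by
    unfold interactionEnergy
    refine Finset.sum_congr rfl fun i _ => Finset.sum_congr rfl fun j _ => ?_
    rw [hdist2]
  -- Good transports from `y` to `x`
  have hdist1 : ∀ (i j : Fin n) (A : EuclideanSpace ℝ (Fin 3) →ₗᵢ[ℝ] EuclideanSpace ℝ (Fin 3))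
      (p : EuclideanSpace ℝ (Fin 3)), dist (x j) (x i + (B.comp A) p) = dist (y j) (y i + A p) := by
    intro i j A p
    rw [hxy i, hxy j, dist_eq_norm, dist_eq_norm]
    have e : v + B (y j) - (v + B (y i) + (B.comp A) p) = B (y j - (y i + A p)) := by
      simp only [map_sub, map_add, LinearIsometry.coe_comp, Function.comp_apply]; abel
    rw [e, LinearIsometry.norm_map]
  have hgood : ∀ i : Fin n, (∃ A : EuclideanSpace ℝ (Fin 3) →ₗᵢ[ℝ] EuclideanSpace ℝ (Fin 3),
      (∀ p ∈ (hcpPeriodicConfiguration ha hh).points, ‖p‖ ≤ 4 → ∃ j : Fin n, dist (y j) (y i + A p) ≤ θ) ∧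
      (∀ j : Fin n, dist (y j) (y i) ≤ 4 → ∃ p ∈ (hcpPeriodicConfiguration ha hh).points,
        dist (y j) (y i + A p) ≤ θ)) →
      (∃ A : EuclideanSpace ℝ (Fin 3) →ₗᵢ[ℝ] EuclideanSpace ℝ (Fin 3),
      (∀ p ∈ (hcpPeriodicConfiguration ha hh).points, ‖p‖ ≤ 4 → ∃ j : Fin n, dist (x j) (x i + A p) ≤ θ) ∧
      (∀ j : Fin n, dist (x j) (x i) ≤ 4 → ∃ p ∈ (hcpPeriodicConfiguration ha hh).points,
        dist (x j) (x i + A p) ≤ θ)) := by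
    rintro i ⟨A, h1, h2⟩
    refine ⟨B.comp A, fun p hp hp4 => ?_, fun j hj => ?_⟩
    · obtain ⟨j, hj⟩ := h1 p hp hp4
      exact ⟨j, by rw [hdist1]; exact hj⟩
    · obtain ⟨p, hp, hpj⟩ := h2 j (by rw [← hdist2]; exact hj)
      exact ⟨p, hp, by rw [hdist1]; exact hpj⟩
  have hcard : Nat.card {i : Fin n // ¬ (∃ A : EuclideanSpace ℝ (Fin 3) →ₗᵢ[ℝ] EuclideanSpace ℝ (Fin 3),
      (∀ p ∈ (hcpPeriodicConfiguration ha hh).points, ‖p‖ ≤ 4 → ∃ j : Fin n, dist (x j) (x i + A p) ≤ θ) ∧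
      (∀ j : Fin n, dist (x j) (x i) ≤ 4 → ∃ p ∈ (hcpPeriodicConfiguration ha hh).points,
        dist (x j) (x i + A p) ≤ θ))} ≤
      Nat.card {i : Fin n // ¬ (∃ A : EuclideanSpace ℝ (Fin 3) →ₗᵢ[ℝ] EuclideanSpace ℝ (Fin 3),
      (∀ p ∈ (hcpPeriodicConfiguration ha hh).points, ‖p‖ ≤ 4 → ∃ j : Fin n, dist (y j) (y i + A p) ≤ θ) ∧
      (∀ j : Fin n, dist (y j) (y i) ≤ 4 → ∃ p ∈ (hcpPeriodicConfiguration ha hh).points,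
        dist (y j) (y i + A p) ≤ θ))} :=
    Nat.card_le_card_of_injective (fun i => ⟨i.1, fun hg => i.2 (hgood i.1 hg)⟩)
      fun i j hij => by
        apply Subtype.ext
        simpa [Subtype.mk.injEq] using hij
  have hcardR : (Nat.card {i : Fin n // ¬ (∃ A : EuclideanSpace ℝ (Fin 3) →ₗᵢ[ℝ] EuclideanSpace ℝ (Fin 3),
      (∀ p ∈ (hcpPeriodicConfiguration ha hh).points, ‖p‖ ≤ 4 → ∃ j : Fin n, dist (x j) (x i + A p) ≤ θ) ∧
      (∀ j : Fin n, dist (x j) (x i) ≤ 4 → ∃ p ∈ (hcpPeriodicConfiguration ha hh).points,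
        dist (x j) (x i + A p) ≤ θ))} : ℝ) ≤
      (Nat.card {i : Fin n // ¬ (∃ A : EuclideanSpace ℝ (Fin 3) →ₗᵢ[ℝ] EuclideanSpace ℝ (Fin 3),
      (∀ p ∈ (hcpPeriodicConfiguration ha hh).points, ‖p‖ ≤ 4 → ∃ j : Fin n, dist (y j) (y i + A p) ≤ θ) ∧
      (∀ j : Fin n, dist (y j) (y i) ≤ 4 → ∃ p ∈ (hcpPeriodicConfiguration ha hh).points,
        dist (y j) (y i + A p) ≤ θ))} : ℝ) := by exact_mod_cast hcard
  rw [hE]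
  have hκc := mul_le_mul_of_nonneg_left hcardR hκ.le
  linarith [h, hκc]

end Summit.AtomisticToContinuum.Crystallization.Theorems.HcpLandscapeGapBirth

end
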